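import Mathlib
import HarnessLib
import Summits.ResolutionOfSingularities.ResolutionOfSingularities.Theorems.WildQuotientsWildQuotientResolutionS1aCoarseChart
import Literature.AlgebraicGeometry.Resolution.AffineBlowupAlgebra

/-!
# S1a — (G1b) COARSE CHART IDENTITY: the blow-up chart `D₊(b t)` of `Bl_{K d}(Spec 𝒜₀)` IS the coarse chart

[OURS · L1 W4.5c · lead-1 g6] — NOT a statement of the manuscript; counted 0; AI-level work, weaker than expert
review. Crux stmt-ResolutionOfSingularities-17941 (`WildQuotients.CyclicQuotientFourfolds`), line `s1a-logminvertex`,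
stub `stub_localGame` (producer), residue **(G1b)** of idea-2ʼs H3-scheme (`h123/H3-SCHEME.md` §2; plan-1 RULING
2026-08-27T21:04:06Z Q1 «the coarse move is the ORDINARY blow-up `Bl_{K d}(V)`», RE-ASSIGN 21:37:59Z «lead-1:
A5b-(G1b) chart identity via `coarseChart`»).

Setting (H4a `…S1aCoarseChart`, p572350): `B` graded by `𝒜 : ι → AddSubgroup B`, a weighted centre `(f, w)`,
`K = CoarseChart.traceFiltration 𝒜 f w` the degree-`0` trace of the weighted filtration (ideals of `𝒜 0`),
`b ∈ K d`, the cover element `h = b T^d ∈ R^w = cobordantAlgebra f w` (`CoarseChart.coverElement`), the chart ring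
`R^w[h⁻¹]` (`CoarseChart.ChartRing`) and its subring `CoarseChart.coarseChart` generated over `𝒜 0` by the
fractions `x T^d / h`, `x ∈ K d`.

What is here (all PROVED; no Veronese hypothesis except where stated):
* `reesToCobordant` — the ring map `Rees_{𝒜 0}(K d) = ⊕ₙ (K d)ⁿ tⁿ → R^w`, `y tⁿ ↦ y T^{d n}` (a polynomial in `t`
  over `𝒜 0` is evaluated at `T^d` in `B[T;T⁻¹]`; it lands in `R^w = ⊕ₘ 𝒥ₘ Tᵐ` because `(K d)ⁿ ≤ K (d n) ≤ 𝒥_{dn}`);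
  `reesToCobordant (b t) = h`.
* `coarseChartMap` — the induced map `ψ : (Rees(K d))_{(b t)} → R^w[h⁻¹]` on the degree-`0` localisation (tree
  model of the blow-up chart `D₊(b t)`, `HomogeneousLocalization.Away (reesGrading (K d)) (reesT b hb)` of
  `AffineBlowup.lean`; compare the treeʼs `reesChart` into `𝒜₀[1/b]`), with `coarseChartMap_mk` (value on a
  fraction `y tⁿ/(b t)ⁿ` = `y T^{dn} / hⁿ`) and `coarseChartMap_reesChartBase` (compatibility with `𝒜 0`).
* `coarseChartMap_injective` (clearing denominators inside `B[T;T⁻¹]`) and `range_coarseChartMap`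
  (`= coarseChart`), packaged as **`coarseChartEquiv : (Rees(K d))_{(b t)} ≃+* coarseChart`** — so, composed with the
  treeʼs `reesChartEquiv`, the coarse chart ring is the affine blow-up algebra `𝒜₀[K d / b]` (Stacks 052Q/0804).
* `mk'_mem_coarseChart_of_mem_pow` — `y T^{dn}/hⁿ ∈ coarseChart` for `y ∈ (K d)ⁿ`; hence, under
  `VeroneseNormalised d` (`K (d n) = (K d)ⁿ`, (G1a) PROVED in `…S1aVeroneseNormalisation`),
  **`mk'_mem_coarseChart_of_veronese`**: EVERY fraction `y T^{dn}/hⁿ` with `y ∈ K (d n)` lies in the coarse chart —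
  the substantive half of «`coarseChart` = the bidegree-`(0,0)` part of the Rees bigrading of `R^w[h⁻¹]`» (the
  other half is immediate once that bigrading is constructed: generators have bidegree `(0,0)`).
-/

set_option linter.dupNamespace false

noncomputable section

open Polynomial Literature.AlgebraicGeometry.Resolution
open scoped LaurentPolynomial

namespace Summit.ResolutionOfSingularities.ResolutionOfSingularities.Theorems.WildQuotientResolution.S1.CoarseChart

universe u v

variable {ι : Type v} [AddCommGroup ι] [DecidableEq ι] {B : Type u} [CommRing B]
  (𝒜 : ι → AddSubgroup B) [GradedRing 𝒜] {c : ℕ} (f : Fin c → B) (w : Fin c → ℕ)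
  (d : ℕ) (b : ↥(𝒜 0)) (hb : b ∈ (traceFiltration 𝒜 f w).ideal d)

/-! ## The Veronese-type map `Rees_{𝒜 0}(K d) → R^w`, `t ↦ T^d` -/

/-- The evaluation `(𝒜 0)[t] → B[T;T⁻¹]`, `y ↦ C y`, `t ↦ T^d`. -/
def evalTd : (↥(𝒜 0))[X] →+* B[T;T⁻¹] :=
  Polynomial.eval₂RingHom (LaurentPolynomial.C.comp (algebraMap (↥(𝒜 0)) B)) (LaurentPolynomial.T (d : ℤ))

/-- `evalTd` on a monomial: `y tⁿ ↦ C y · T^{d n}`. -/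
theorem evalTd_monomial (n : ℕ) (y : ↥(𝒜 0)) :
    evalTd 𝒜 d (monomial n y) = LaurentPolynomial.C (y : B) * LaurentPolynomial.T ((d * n : ℕ) : ℤ) := by
  rw [evalTd, Polynomial.coe_eval₂RingHom, Polynomial.eval₂_monomial, LaurentPolynomial.T_pow]
  simp [mul_comm (d : ℤ)]

/-- `(K d)ⁿ ≤ K (d n)` read in `B`: an element of `(K d)ⁿ` lies in `𝒥_{d n}`. -/
theorem coe_mem_weightedFiltration_of_mem_pow {n : ℕ} {y : ↥(𝒜 0)}
    (hy : y ∈ (traceFiltration 𝒜 f w).ideal d ^ n) :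
    (y : B) ∈ (weightedFiltration f w).ideal (d * n) :=
  (mem_traceFiltration_iff 𝒜 f w).mp (pow_le_traceFiltration 𝒜 f w d n hy)

/-- The Rees algebra of `K d` maps into the cobordant algebra under `evalTd`. -/
theorem evalTd_mem_cobordantAlgebra (p : ↥(reesAlgebra ((traceFiltration 𝒜 f w).ideal d))) :
    evalTd 𝒜 d (p : (↥(𝒜 0))[X]) ∈ cobordantAlgebra f w := by
  rw [(p : (↥(𝒜 0))[X]).as_sum_support, map_sum]
  refine Subalgebra.sum_mem _ fun n hn => ?_
  rw [evalTd_monomial]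
  exact C_mul_T_mem_cobordantAlgebra f w
    (coe_mem_weightedFiltration_of_mem_pow 𝒜 f w d ((mem_reesAlgebra_iff _ _).mp p.2 n))

/-- **`Rees_{𝒜 0}(K d) → R^w`**, `y tⁿ ↦ y T^{dn}`. [OURS · L1 W4.5c] -/
def reesToCobordant : ↥(reesAlgebra ((traceFiltration 𝒜 f w).ideal d)) →+* ↥(cobordantAlgebra f w) :=
  ((evalTd 𝒜 d).comp (reesAlgebra ((traceFiltration 𝒜 f w).ideal d)).val.toRingHom).codRestrict
    (cobordantAlgebra f w).toSubring (evalTd_mem_cobordantAlgebra 𝒜 f w d)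

/-- Underlying Laurent polynomial of `reesToCobordant p`. -/
@[simp] theorem coe_reesToCobordant (p : ↥(reesAlgebra ((traceFiltration 𝒜 f w).ideal d))) :
    ((reesToCobordant 𝒜 f w d p : ↥(cobordantAlgebra f w)) : B[T;T⁻¹]) = evalTd 𝒜 d (p : (↥(𝒜 0))[X]) :=
  rfl

/-- `reesToCobordant` of an element with underlying polynomial `y tⁿ` is the cover-type element `y T^{dn}`. -/
theorem reesToCobordant_of_eq_monomial {p : ↥(reesAlgebra ((traceFiltration 𝒜 f w).ideal d))} {n : ℕ}
    {y : ↥(𝒜 0)} (hp : (p : (↥(𝒜 0))[X]) = monomial n y) (hy : y ∈ (traceFiltration 𝒜 f w).ideal (d * n)) :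
    reesToCobordant 𝒜 f w d p = coverElement 𝒜 f w (d * n) y hy := by
  refine Subtype.ext ?_
  rw [coe_reesToCobordant, hp, evalTd_monomial, coe_coverElement]

/-- `reesToCobordant (b t) = h = b T^d`. -/
theorem reesToCobordant_reesT :
    reesToCobordant 𝒜 f w d (reesT b hb) = coverElement 𝒜 f w d b hb := by
  have hb' : b ∈ (traceFiltration 𝒜 f w).ideal (d * 1) := by rwa [mul_one]
  rw [reesToCobordant_of_eq_monomial 𝒜 f w d (coe_reesT b hb) hb']
  exact Subtype.ext (by simp [coe_coverElement])

/-! ## The chart map `ψ : (Rees(K d))_{(b t)} → R^w[h⁻¹]` -/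

/-- The image of `b t` in the chart ring is a unit. -/
theorem isUnit_algebraMap_reesToCobordant_reesT :
    IsUnit (((algebraMap _ (ChartRing 𝒜 f w d b hb)).comp (reesToCobordant 𝒜 f w d)) (reesT b hb)) := by
  rw [RingHom.comp_apply, reesToCobordant_reesT]
  exact IsLocalization.Away.algebraMap_isUnit _

/-- `y T^0 = C y` is the structure-map image of `y`. -/
theorem coverElement_mul_zero (y : ↥(𝒜 0)) (hy : y ∈ (traceFiltration 𝒜 f w).ideal (d * 0)) :
    coverElement 𝒜 f w (d * 0) y hy = algebraMap B (↥(cobordantAlgebra f w)) (algebraMap (↥(𝒜 0)) B y) := by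
  refine Subtype.ext ?_
  rw [coe_coverElement, cobordantAlgebra.coe_algebraMap]
  simp

/-- The structure map of the chart ring, unfolded. -/
theorem toChartRing_apply (y : ↥(𝒜 0)) :
    toChartRing 𝒜 f w d b hb y =
      algebraMap _ (ChartRing 𝒜 f w d b hb) (algebraMap B (↥(cobordantAlgebra f w)) (algebraMap (↥(𝒜 0)) B y)) :=
  rfl

/-- **The coarse chart map** `ψ : (Rees_{𝒜 0}(K d))_{(b t)} → R^w[(b T^d)⁻¹]`, `y tⁿ/(b t)ⁿ ↦ y T^{dn}/(b T^d)ⁿ`.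
[OURS · L1 W4.5c] -/
def coarseChartMap :
    HomogeneousLocalization.Away (reesGrading ((traceFiltration 𝒜 f w).ideal d)) (reesT b hb) →+*
      ChartRing 𝒜 f w d b hb :=
  (IsLocalization.Away.lift (reesT b hb)
      (g := (algebraMap _ (ChartRing 𝒜 f w d b hb)).comp (reesToCobordant 𝒜 f w d))
      (isUnit_algebraMap_reesToCobordant_reesT 𝒜 f w d b hb) :
      Localization.Away (reesT b hb) →+* ChartRing 𝒜 f w d b hb).comp
    (algebraMap (HomogeneousLocalization.Away (reesGrading ((traceFiltration 𝒜 f w).ideal d)) (reesT b hb))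
      (Localization.Away (reesT b hb)))

/-- `ψ (x/(b t)ⁿ) · hⁿ = reesToCobordant x` (read in the chart ring). -/
theorem coarseChartMap_mk_mul_pow (n : ℕ) (x : ↥(reesAlgebra ((traceFiltration 𝒜 f w).ideal d)))
    (hx : x ∈ reesGrading ((traceFiltration 𝒜 f w).ideal d) (n • 1)) :
    coarseChartMap 𝒜 f w d b hb
        (HomogeneousLocalization.Away.mk (reesGrading _) (reesT_mem b hb) n x hx) *
      algebraMap _ (ChartRing 𝒜 f w d b hb) (coverElement 𝒜 f w d b hb) ^ n =
      algebraMap _ (ChartRing 𝒜 f w d b hb) (reesToCobordant 𝒜 f w d x) := by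
  have hunit := isUnit_algebraMap_reesToCobordant_reesT 𝒜 f w d b hb
  have hA : algebraMap _ (ChartRing 𝒜 f w d b hb) (coverElement 𝒜 f w d b hb) ^ n =
      IsLocalization.Away.lift (reesT b hb) hunit
        (algebraMap _ (Localization.Away (reesT b hb)) (reesT b hb ^ n)) := by
    rw [IsLocalization.Away.lift_eq, map_pow, RingHom.comp_apply, reesToCobordant_reesT]
  change IsLocalization.Away.lift (reesT b hb) hunit
      ((HomogeneousLocalization.Away.mk (reesGrading _) (reesT_mem b hb) n x hx).val) * _ = _
  rw [hA, ← map_mul, HomogeneousLocalization.Away.val_mk, Localization.mk_eq_mk']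
  erw [IsLocalization.mk'_spec]
  rw [IsLocalization.Away.lift_eq, RingHom.comp_apply]

/-- **`ψ` on fractions**: `ψ (x/(b t)ⁿ) = reesToCobordant x / hⁿ` as an `IsLocalization.mk'`. -/
theorem coarseChartMap_mk (n : ℕ) (x : ↥(reesAlgebra ((traceFiltration 𝒜 f w).ideal d)))
    (hx : x ∈ reesGrading ((traceFiltration 𝒜 f w).ideal d) (n • 1)) :
    coarseChartMap 𝒜 f w d b hb
        (HomogeneousLocalization.Away.mk (reesGrading _) (reesT_mem b hb) n x hx) =
      IsLocalization.mk' (ChartRing 𝒜 f w d b hb) (reesToCobordant 𝒜 f w d x)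
        (⟨coverElement 𝒜 f w d b hb ^ n, n, rfl⟩ : Submonoid.powers (coverElement 𝒜 f w d b hb)) := by
  rw [IsLocalization.eq_mk'_iff_mul_eq]
  have h := coarseChartMap_mk_mul_pow 𝒜 f w d b hb n x hx
  rwa [← map_pow] at h

/-- The structure map of the blow-up chart composed with `ψ` is the structure map of the chart ring:
`ψ (r/1) = toChartRing r`. -/
theorem coarseChartMap_reesChartBase (r : ↥(𝒜 0)) :
    coarseChartMap 𝒜 f w d b hb (reesChartBase b hb r) = toChartRing 𝒜 f w d b hb r := by
  have hunit := isUnit_algebraMap_reesToCobordant_reesT 𝒜 f w d b hb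
  change IsLocalization.Away.lift (reesT b hb) hunit
    (HomogeneousLocalization.val (HomogeneousLocalization.mk _)) = _
  rw [HomogeneousLocalization.val_mk]
  change IsLocalization.Away.lift (reesT b hb) hunit
    (Localization.mk (algebraMap (↥(𝒜 0)) (↥(reesAlgebra ((traceFiltration 𝒜 f w).ideal d))) r) 1) = _
  rw [Localization.mk_one_eq_algebraMap, IsLocalization.Away.lift_eq, RingHom.comp_apply]
  have h0 : r ∈ (traceFiltration 𝒜 f w).ideal (d * 0) := by
    rw [mul_zero, (traceFiltration 𝒜 f w).ideal_zero]; trivial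
  rw [reesToCobordant_of_eq_monomial 𝒜 f w d (n := 0) (y := r) (by rw [monomial_zero_left]; rfl) h0]
  change _ = algebraMap _ (ChartRing 𝒜 f w d b hb) (algebraMap B (↥(cobordantAlgebra f w)) (algebraMap _ B r))
  congr 1
  refine Subtype.ext ?_
  rw [coe_coverElement]
  simp

/-! ## Range and injectivity -/

/-- `y T^{dn} / hⁿ ∈ coarseChart` for `y ∈ (K d)ⁿ` (induction on `n`: peel one factor `x T^d / h`, `x ∈ K d`).
[OURS · L1 W4.5c] -/
theorem mk'_mem_coarseChart_of_mem_pow :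
    ∀ (n : ℕ) {y : ↥(𝒜 0)} (_ : y ∈ (traceFiltration 𝒜 f w).ideal d ^ n)
      (hy' : y ∈ (traceFiltration 𝒜 f w).ideal (d * n)),
      IsLocalization.mk' (ChartRing 𝒜 f w d b hb) (coverElement 𝒜 f w (d * n) y hy')
          (⟨coverElement 𝒜 f w d b hb ^ n, n, rfl⟩ : Submonoid.powers (coverElement 𝒜 f w d b hb)) ∈
        coarseChart 𝒜 f w d b hb
  | 0, y, _, hy' => by
    have h1 : ((⟨coverElement 𝒜 f w d b hb ^ 0, 0, rfl⟩ : Submonoid.powers (coverElement 𝒜 f w d b hb))) = 1 :=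
      Subtype.ext (pow_zero _)
    rw [h1, IsLocalization.mk'_one, coverElement_mul_zero, ← toChartRing_apply]
    exact toChartRing_mem_coarseChart 𝒜 f w d b hb y
  | n + 1, y, hy, hy' => by
    -- induction over `(K d)ⁿ · (K d)` with the membership proof carried along
    suffices key : ∀ z ∈ (traceFiltration 𝒜 f w).ideal d ^ n * (traceFiltration 𝒜 f w).ideal d,
        ∃ hz' : z ∈ (traceFiltration 𝒜 f w).ideal (d * (n + 1)),
          IsLocalization.mk' (ChartRing 𝒜 f w d b hb) (coverElement 𝒜 f w (d * (n + 1)) z hz')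
              (⟨coverElement 𝒜 f w d b hb ^ (n + 1), n + 1, rfl⟩ :
                Submonoid.powers (coverElement 𝒜 f w d b hb)) ∈ coarseChart 𝒜 f w d b hb by
      obtain ⟨_, h⟩ := key y (by rwa [pow_succ] at hy)
      exact h
    intro z hz
    refine Submodule.mul_induction_on hz (fun s hs t ht => ?_) (fun y₁ y₂ hy₁ hy₂ => ?_)
    · -- `(s t) T^{d(n+1)} / h^{n+1} = (s T^{dn}/hⁿ) · (t T^d / h)`
      have hs' : s ∈ (traceFiltration 𝒜 f w).ideal (d * n) := pow_le_traceFiltration 𝒜 f w d n hs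
      have hst' : s * t ∈ (traceFiltration 𝒜 f w).ideal (d * (n + 1)) :=
        pow_le_traceFiltration 𝒜 f w d (n + 1) (by rw [pow_succ]; exact Ideal.mul_mem_mul hs ht)
      refine ⟨hst', ?_⟩
      have hmul : IsLocalization.mk' (ChartRing 𝒜 f w d b hb) (coverElement 𝒜 f w (d * (n + 1)) (s * t) hst')
          (⟨coverElement 𝒜 f w d b hb ^ (n + 1), n + 1, rfl⟩ : Submonoid.powers (coverElement 𝒜 f w d b hb)) =
        IsLocalization.mk' (ChartRing 𝒜 f w d b hb) (coverElement 𝒜 f w (d * n) s hs')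
          (⟨coverElement 𝒜 f w d b hb ^ n, n, rfl⟩ : Submonoid.powers (coverElement 𝒜 f w d b hb)) *
          chartFraction 𝒜 f w d b hb t ht := by
        rw [chartFraction, ← IsLocalization.mk'_mul]
        congr 1
        · refine Subtype.ext ?_
          have hst : ((s * t : ↥(𝒜 0)) : B) = (s : B) * (t : B) := rfl
          simp only [coe_coverElement, MulMemClass.coe_mul, hst, map_mul, Nat.cast_mul, Nat.cast_add,
            Nat.cast_one]
          rw [mul_add, mul_one, LaurentPolynomial.T_add]
          ring
      rw [hmul]
      exact Subring.mul_mem _ (mk'_mem_coarseChart_of_mem_pow n hs hs')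
        (chartFraction_mem_coarseChart 𝒜 f w d b hb t ht)
    · obtain ⟨h₁, P₁⟩ := hy₁
      obtain ⟨h₂, P₂⟩ := hy₂
      refine ⟨add_mem h₁ h₂, ?_⟩
      have hadd : IsLocalization.mk' (ChartRing 𝒜 f w d b hb)
          (coverElement 𝒜 f w (d * (n + 1)) (y₁ + y₂) (add_mem h₁ h₂))
          (⟨coverElement 𝒜 f w d b hb ^ (n + 1), n + 1, rfl⟩ : Submonoid.powers (coverElement 𝒜 f w d b hb)) =
        IsLocalization.mk' (ChartRing 𝒜 f w d b hb) (coverElement 𝒜 f w (d * (n + 1)) y₁ h₁)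
          (⟨coverElement 𝒜 f w d b hb ^ (n + 1), n + 1, rfl⟩ : Submonoid.powers (coverElement 𝒜 f w d b hb)) +
        IsLocalization.mk' (ChartRing 𝒜 f w d b hb) (coverElement 𝒜 f w (d * (n + 1)) y₂ h₂)
          (⟨coverElement 𝒜 f w d b hb ^ (n + 1), n + 1, rfl⟩ : Submonoid.powers (coverElement 𝒜 f w d b hb)) := by
        have hcov : coverElement 𝒜 f w (d * (n + 1)) (y₁ + y₂) (add_mem h₁ h₂) =
            coverElement 𝒜 f w (d * (n + 1)) y₁ h₁ + coverElement 𝒜 f w (d * (n + 1)) y₂ h₂ := by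
          refine Subtype.ext ?_
          have h12 : ((y₁ + y₂ : ↥(𝒜 0)) : B) = (y₁ : B) + (y₂ : B) := rfl
          simp only [coe_coverElement, AddMemClass.coe_add, h12, map_add, add_mul]
        rw [IsLocalization.mk'_eq_mul_mk'_one, hcov, map_add, add_mul, ← IsLocalization.mk'_eq_mul_mk'_one,
          ← IsLocalization.mk'_eq_mul_mk'_one]
      rw [hadd]
      exact add_mem P₁ P₂

/-- **The range of `ψ` is the coarse chart.** [OURS · L1 W4.5c] -/
theorem range_coarseChartMap :
    Set.range (coarseChartMap 𝒜 f w d b hb) = (coarseChart 𝒜 f w d b hb : Set (ChartRing 𝒜 f w d b hb)) := by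
  apply le_antisymm
  · rintro _ ⟨z, rfl⟩
    obtain ⟨n, x, hx, rfl⟩ := HomogeneousLocalization.Away.mk_surjective (reesGrading _) (reesT_mem b hb) z
    obtain ⟨y, hy⟩ := (mem_reesGrading_iff _).mp hx
    have hn : (n • 1 : ℕ) = n := by simp
    have hy' : (x : (↥(𝒜 0))[X]) = monomial n y := by rw [← hy, hn]
    have hyK : y ∈ (traceFiltration 𝒜 f w).ideal d ^ n := by
      have := x.2
      rw [hy', reesAlgebra.monomial_mem] at this
      exact this
    change coarseChartMap 𝒜 f w d b hb _ ∈ coarseChart 𝒜 f w d b hb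
    rw [coarseChartMap_mk, reesToCobordant_of_eq_monomial 𝒜 f w d hy' (pow_le_traceFiltration 𝒜 f w d n hyK)]
    exact mk'_mem_coarseChart_of_mem_pow 𝒜 f w d b hb n hyK _
  · -- the coarse chart is generated by `toChartRing r = ψ (r/1)` and `x T^d/h = ψ ((x t)/(b t))`
    let T : Subring (ChartRing 𝒜 f w d b hb) :=
      { carrier := Set.range (coarseChartMap 𝒜 f w d b hb)
        mul_mem' := by
          rintro _ _ ⟨y₁, rfl⟩ ⟨y₂, rfl⟩
          exact ⟨y₁ * y₂, (coarseChartMap 𝒜 f w d b hb).map_mul y₁ y₂⟩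
        one_mem' := ⟨1, (coarseChartMap 𝒜 f w d b hb).map_one⟩
        add_mem' := by
          rintro _ _ ⟨y₁, rfl⟩ ⟨y₂, rfl⟩
          exact ⟨y₁ + y₂, (coarseChartMap 𝒜 f w d b hb).map_add y₁ y₂⟩
        zero_mem' := ⟨0, (coarseChartMap 𝒜 f w d b hb).map_zero⟩
        neg_mem' := by
          rintro _ ⟨y, rfl⟩
          exact ⟨-y, (coarseChartMap 𝒜 f w d b hb).map_neg y⟩ }
    change coarseChart 𝒜 f w d b hb ≤ T
    rw [coarseChart, Subring.closure_le]
    rintro z (⟨r, rfl⟩ | ⟨x, hx, rfl⟩)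
    · exact ⟨reesChartBase b hb r, coarseChartMap_reesChartBase 𝒜 f w d b hb r⟩
    · refine ⟨HomogeneousLocalization.Away.mk (reesGrading _) (reesT_mem b hb) 1 (reesT x hx)
        (by simpa using reesT_mem x hx), ?_⟩
      have hx' : x ∈ (traceFiltration 𝒜 f w).ideal (d * 1) := by rwa [mul_one]
      rw [coarseChartMap_mk, reesToCobordant_of_eq_monomial 𝒜 f w d (coe_reesT x hx) hx', chartFraction]
      congr 1
      · exact Subtype.ext (by simp [coe_coverElement])
      · exact Subtype.ext (pow_one _)

/-- `C a · Tⁿ = 0` in `B[T;T⁻¹]` forces `a = 0`. -/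
theorem eq_zero_of_C_mul_T_eq_zero {a : B} {n : ℤ} (h : LaurentPolynomial.C a * LaurentPolynomial.T n = 0) :
    a = 0 := by
  have := congrArg (fun p : B[T;T⁻¹] => p.coeff n) h
  simpa [← LaurentPolynomial.single_eq_C_mul_T, AddMonoidAlgebra.coeff_single] using this

/-- **`ψ` is injective** (clear denominators in `B[T;T⁻¹]`: `hᵏ · y T^{dn} = 0` forces `bᵏ y = 0`, and then
`y tⁿ/(b t)ⁿ = bᵏ y t^{n+k}/(b t)^{n+k} = 0`). [OURS · L1 W4.5c] -/
theorem coarseChartMap_injective : Function.Injective (coarseChartMap 𝒜 f w d b hb) := by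
  intro z₁ z₂ h12
  rw [← sub_eq_zero]
  have hz : coarseChartMap 𝒜 f w d b hb (z₁ - z₂) = 0 := by
    have hsub := map_sub (coarseChartMap 𝒜 f w d b hb) z₁ z₂
    rw [hsub, h12, sub_self]
  generalize z₁ - z₂ = z at hz ⊢
  obtain ⟨n, x, hx, rfl⟩ := HomogeneousLocalization.Away.mk_surjective (reesGrading _) (reesT_mem b hb) z
  obtain ⟨y, hy⟩ := (mem_reesGrading_iff _).mp hx
  have hn : (n • 1 : ℕ) = n := by simp
  have hy' : (x : (↥(𝒜 0))[X]) = monomial n y := by rw [← hy, hn]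
  have hyK : y ∈ (traceFiltration 𝒜 f w).ideal d ^ n := by
    have := x.2
    rw [hy', reesAlgebra.monomial_mem] at this
    exact this
  rw [coarseChartMap_mk, reesToCobordant_of_eq_monomial 𝒜 f w d hy' (pow_le_traceFiltration 𝒜 f w d n hyK),
    IsLocalization.mk'_eq_zero_iff] at hz
  obtain ⟨⟨_, k, rfl⟩, hk⟩ := hz
  -- `hk : h^k * (y T^{dn}) = 0` in `R^w`; read it in `B[T;T⁻¹]`
  have hB : (b : B) ^ k * (y : B) = 0 := by
    have := congrArg (fun q : ↥(cobordantAlgebra f w) => (q : B[T;T⁻¹])) hk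
    simp only [MulMemClass.coe_mul, SubmonoidClass.coe_pow, coe_coverElement, ZeroMemClass.coe_zero] at this
    rw [mul_pow, ← map_pow, LaurentPolynomial.T_pow, mul_mul_mul_comm, ← map_mul,
      ← LaurentPolynomial.T_add] at this
    exact eq_zero_of_C_mul_T_eq_zero this
  -- hence the fraction vanishes in the blow-up chart
  refine HomogeneousLocalization.val_injective _ ?_
  rw [HomogeneousLocalization.Away.val_mk, HomogeneousLocalization.val_zero, Localization.mk_eq_mk',
    IsLocalization.mk'_eq_zero_iff]
  refine ⟨⟨reesT b hb ^ k, k, rfl⟩, Subtype.ext ?_⟩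
  change ((reesT b hb : ↥(reesAlgebra _)) : (↥(𝒜 0))[X]) ^ k * (x : (↥(𝒜 0))[X]) = 0
  rw [coe_reesT, hy', monomial_pow, monomial_mul_monomial]
  have : b ^ k * y = 0 := Subtype.ext (by simpa using hB)
  rw [this, monomial_zero_right]

/-- **(G1b) COARSE CHART IDENTITY**: the blow-up chart ring `(Rees_{𝒜 0}(K d))_{(b t)}` (the treeʼs model of
`Γ(D₊(b t), 𝒪)` on `Bl_{K d}(Spec 𝒜 0)`, `AffineBlowup.lean`; `≅ 𝒜₀[K d/b]` by `reesChartEquiv`) is isomorphic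
to the coarse chart ring inside `R^w[(b T^d)⁻¹]`, compatibly with the structure maps from `𝒜 0`. [OURS · L1 W4.5c] -/
def coarseChartEquiv :
    HomogeneousLocalization.Away (reesGrading ((traceFiltration 𝒜 f w).ideal d)) (reesT b hb) ≃+*
      ↥(coarseChart 𝒜 f w d b hb) :=
  RingEquiv.ofBijective
    ((coarseChartMap 𝒜 f w d b hb).codRestrict (coarseChart 𝒜 f w d b hb) fun z => by
      have hz : coarseChartMap 𝒜 f w d b hb z ∈ Set.range (coarseChartMap 𝒜 f w d b hb) := ⟨z, rfl⟩
      rw [range_coarseChartMap] at hz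
      exact hz)
    ⟨fun z₁ z₂ h => coarseChartMap_injective 𝒜 f w d b hb (congrArg Subtype.val h), fun z => by
      have hz : (z : ChartRing 𝒜 f w d b hb) ∈ Set.range (coarseChartMap 𝒜 f w d b hb) := by
        rw [range_coarseChartMap]; exact z.2
      obtain ⟨y, hy⟩ := hz
      exact ⟨y, Subtype.ext hy⟩⟩

/-- The isomorphism is the chart map. -/
@[simp] theorem coe_coarseChartEquiv
    (z : HomogeneousLocalization.Away (reesGrading ((traceFiltration 𝒜 f w).ideal d)) (reesT b hb)) :
    (coarseChartEquiv 𝒜 f w d b hb z : ChartRing 𝒜 f w d b hb) = coarseChartMap 𝒜 f w d b hb z :=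
  rfl

/-- Compatibility with the structure maps: `coarseChartEquiv (r/1) = toChartRing r`. -/
theorem coarseChartEquiv_reesChartBase (r : ↥(𝒜 0)) :
    (coarseChartEquiv 𝒜 f w d b hb (reesChartBase b hb r) : ChartRing 𝒜 f w d b hb) =
      toChartRing 𝒜 f w d b hb r :=
  coarseChartMap_reesChartBase 𝒜 f w d b hb r

/-! ## With a Veronese degree: every bidegree-`(0,0)` fraction lies in the coarse chart -/

/-- **(G1b) with (G1a)**: if `d` is a Veronese degree (`K (d n) = (K d)ⁿ`), EVERY fraction `y T^{dn}/hⁿ` with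
`y ∈ K (d n)` lies in the coarse chart — the coarse chart exhausts the bidegree-`(0,0)` fractions of `R^w[h⁻¹]`.
[OURS · L1 W4.5c] -/
theorem mk'_mem_coarseChart_of_veronese (hd : VeroneseNormalised 𝒜 f w d) (n : ℕ) {y : ↥(𝒜 0)}
    (hy : y ∈ (traceFiltration 𝒜 f w).ideal (d * n)) :
    IsLocalization.mk' (ChartRing 𝒜 f w d b hb) (coverElement 𝒜 f w (d * n) y hy)
        (⟨coverElement 𝒜 f w d b hb ^ n, n, rfl⟩ : Submonoid.powers (coverElement 𝒜 f w d b hb)) ∈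
      coarseChart 𝒜 f w d b hb := by
  have hy' : y ∈ (traceFiltration 𝒜 f w).ideal d ^ n := by rwa [← hd.2 n]
  exact mk'_mem_coarseChart_of_mem_pow 𝒜 f w d b hb n hy' hy

end Summit.ResolutionOfSingularities.ResolutionOfSingularities.Theorems.WildQuotientResolution.S1.CoarseChart

end
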